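import Summits.BirchSwinnertonDyer.BirchSwinnertonDyer.Theorems.ResidualThetaTransportAtTwoResidualThetaMainConjectureAtTwoPollackPairKConstruction
import Literature.NumberTheory.Automorphic.Sweep1
import HarnessLib

/-!
# Crux `ResidualThetaMainConjectureAtTwo` (stmt-BirchSwinnertonDyer-20787), line `birth` v6 — stub (R1c')
# `stub_pollackCongruencesKAtTwo`: the CONGRUENCE HALF of a Pollack pair of the partner over `𝓞` at `p = 2`

Cell `bsd-wall`, seat `bsd-wall-rtt-p2` (LEAD PROVER, line mode, g2). THEOREMS ONLY (no `def`, no named fact, no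
`sorry`). Proves the registered stub (R1c') of skeleton v6 VERBATIM: for the CM partner datum of the crux (`M` odd,
`g ∈ S₂(Γ₀(M))` a newform, `a₂(g) = 0`) and a COHOMOLOGICAL plus period `Ω` along `ι`, there are `L⁺, L⁻ ∈ 𝓞⟦T⟧`
(`𝓞 = padicCoeffIntegers (range ι)`) satisfying ALL the layer congruences of `IsPollackPairK g ι Ω L⁺ L⁻`
(`θ_n(g;Ω)^ι ≡ (−1)^(⌊n/2⌋+1) ω_n^± L^± (mod ω_n)`, `n` odd/even) — by `exists_isCongrModOmegaO_odd/even` of the file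
`…PollackPairKConstruction` (Pollack 2003 Prop. 6.18 over `𝓞` at `p = 2`). What remains of (R1c) after this: the
non-vanishing `L^± ≠ 0` (Rohrlich, stub R1d) and the norm-λ witness (R1e). BSD is not proved by any of this.

Refs: [Pollack2003] Prop. 6.18; [PollackWeston2011MT] Def. 2.1, Rem. 2.2.
-/

set_option linter.dupNamespace false
set_option autoImplicit false

noncomputable section

open scoped Classical

open Polynomial Literature.NumberTheory.EllipticCurves Literature.NumberTheory.EllipticCurves.ModularForms

namespace Summit.BirchSwinnertonDyer.BirchSwinnertonDyer.Theorems.ResidualThetaLayer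

/-- **Stub (R1c') `stub_pollackCongruencesKAtTwo` of crux `ResidualThetaMainConjectureAtTwo` (line `birth` v6),
VERBATIM**: the congruence half of a Pollack pair of the partner over `𝓞` at `p = 2` at a cohomological period (see
the module docstring). [cite: Pollack2003, Prop. 6.18] [cite: PollackWeston2011MT, Rem. 2.2] -/
theorem stub_pollackCongruencesKAtTwo : ∀ (M : ℕ) [NeZero M] (g : CuspForm (CongruenceSubgroup.Gamma0 M) 2) (ι : Literature.NumberTheory.EllipticCurves.ModularForms.coeffField g →+* PadicAlgCl 2) (Ω : ℂ), Odd M → Literature.NumberTheory.EllipticCurves.ModularForms.IsNewform0 g → Literature.NumberTheory.Automorphic.IsCMForm (Literature.NumberTheory.EllipticCurves.ModularForms.liftToGamma1 M 2 g) → Literature.NumberTheory.EllipticCurves.ModularForms.cuspCoeff g 2 = 0 → Literature.NumberTheory.EllipticCurves.IsCohomologicalPlusPeriod g ι Ω → ∃ (Lp Lm : Literature.NumberTheory.EllipticCurves.IwasawaAlgebraO (Set.range ι)), (∀ n : ℕ, Odd n → Literature.NumberTheory.EllipticCurves.IsCongrModOmegaO (Set.range ι) n ((Literature.NumberTheory.EllipticCurves.mazurTateElementK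 g Ω 2 n).map ι) ((((((-1 : Polynomial ℤ)) ^ (n / 2 + 1) * Literature.NumberTheory.EllipticCurves.cyclotomicOmegaPlus 2 n).map (Int.castRingHom (PadicAlgCl 2)) : Polynomial (PadicAlgCl 2)) : PowerSeries (PadicAlgCl 2)) * Literature.NumberTheory.EllipticCurves.iwasawaOToPowerSeries (Set.range ι) Lp)) ∧ (∀ n : ℕ, Even n → Literature.NumberTheory.EllipticCurves.IsCongrModOmegaO (Set.range ι) n ((Literature.NumberTheory.EllipticCurves.mazurTateElementK g Ω 2 n).map ι) ((((((-1 : Polynomial ℤ)) ^ (n / 2 + 1) * Literature.NumberTheory.EllipticCurves.cyclotomicOmegaMinus 2 n).map (Int.castRingHom (PadicAlgCl 2)) : Polynomial (PadicAlgCl 2)) : PowerSeries (PadicAlgCl 2)) * Literature.NumberTheory.EllipticCurves.iwasawaOToPowerSeries (Set.range ι) Lm)) := by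
  intro M _ g ι Ω hodd hnew _hcm ha2 hΩ
  have h2M : ¬ 2 ∣ M := hodd.not_two_dvd_nat
  obtain ⟨Lm, hLm⟩ := exists_isCongrModOmegaO_even (p := 2) hnew hΩ h2M ha2
  obtain ⟨Lp, hLp⟩ := exists_isCongrModOmegaO_odd (p := 2) hnew hΩ h2M ha2
  refine ⟨Lp, Lm, fun n hn ↦ ?_, fun n hn ↦ ?_⟩
  · obtain ⟨m, rfl⟩ := hn
    rw [show (2 * m + 1) / 2 + 1 = m + 1 by omega]
    exact hLp m
  · obtain ⟨m, rfl⟩ := hn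
    rw [show (m + m) / 2 + 1 = m + 1 by omega, ← two_mul]
    exact hLm m

end Summit.BirchSwinnertonDyer.BirchSwinnertonDyer.Theorems.ResidualThetaLayer

end
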